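import Summits.CriticalPhenomena.PercolationContinuityZ3.Theses.PercCriticalCaps
import Summits.CriticalPhenomena.PercolationContinuityZ3.Theorems.PercNearOneGluingNoHeavyLowerTailCSHTheoremOne
import Literature.Probability.Percolation.SharpnessQuasiTransitiveProofs
import Literature.Probability.Percolation.SiteConnectionTools
import Literature.Probability.Percolation.TwoPointFunction
import Literature.Probability.LatticeModels.LatticeGraph
import Mathlib.MeasureTheory.OuterMeasure.BorelCantelli
import HarnessLib

/-!
# `PercCriticalCaps.CapBelowCritical` (stmt-CriticalPhenomena-7514) — SETTLED after continuity

Item `stmt-CriticalPhenomena-7514` of route `CriticalPhenomena/PercCriticalCaps` (support (calibration)): for `p < p_c(ℤ^d)` (every `d ≥ 1`), almost surely only finitely many `t > 0` have `t·e₀ ↔ {y : y₀ = 0}`.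

First moment / Borel–Cantelli: `P(t e₀ ↔ plane) ≤ Σ_{y₀=0} τ(t e₀, y) = Σ_{y₀=0} τ(0, y − t e₀)` (`tau_eq_tau_zero_sub`), and `(t,y) ↦ y − t e₀` is injective on the plane, so `Σ_t P(E_t) ≤ Σ_z τ(0,z) < ∞` by the PROVED quasi-transitive sharpness `DCTQ.summable_real_openConn_of_lt_criticalProb` (valid for every `d ≥ 1`); `ae_finite_setOf_mem`.  p205010 is NOT used.

builds on p205010 (kernel theorem, internal audit signed; external expert review pending) — USED (`CSH.percolationContinuityZ3_holds`).  RSW3 lane, lead gen 28 (prover-prim-rsw3-lead-g28-0):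
'after continuity — the ledger harvest'.
References: G. Kozma, N. Nitzan (2024), Thm. 6 / Conj. 3 [KozmaNitzan2024]; G. Grimmett, *Percolation* (1999), §8 [GrimmettPercolation1999].
-/

noncomputable section

namespace Summit.CriticalPhenomena.PercolationContinuityZ3.Theorems

namespace PercCriticalCapsCapBelowCritical

open MeasureTheory Literature.Probability.Percolation Literature.Probability.LatticeModels

/-- **`PercCriticalCaps.CapBelowCritical` (stmt-CriticalPhenomena-7514), settled.**  Borel–Cantelli with the subcritical summable two-point function (`DCTQ.summable_real_openConn_of_lt_criticalProb`).
[cite: KozmaNitzan2024, Thm. 6 with Conj. 3 (p. 15)] -/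
theorem capBelowCritical_proof : Summit.CriticalPhenomena.PercolationContinuityZ3.Theses.PercCriticalCaps.CapBelowCritical := by
  intro d _ p hp
  classical
  set μ := bondPercolation (zdGraph d) p with hμ
  -- subcritical summability of the two-point function (PROVED quasi-transitive sharpness, every `d ≥ 1`)
  have hsum : Summable fun x : Site d => μ.real (openConn (0 : Site d) x) :=
    DCTQ.summable_real_openConn_of_lt_criticalProb (zdGraph d) ⟨zdGraph_preconnected_holds⟩ (V₀ := {0})
      (fun v => ⟨zdShiftIso (-v), by simp [zdShiftIso]⟩) 0 p hp
  -- the hit events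
  set E : ℤ → Set (BondConfig (Site d)) := fun t =>
    {ω | 0 < t ∧ ∃ y : Site d, y 0 = 0 ∧ ω ∈ openConn (Pi.single 0 t : Site d) y} with hE
  -- reindexing `(t, y) ↦ y - t e₀` is injective on the plane `y₀ = 0`
  set φ : ℤ × {y : Site d // y 0 = 0} → Site d := fun q => (q.2 : Site d) - Pi.single 0 q.1 with hφ
  have hφinj : Function.Injective φ := by
    rintro ⟨t, y, hy⟩ ⟨t', y', hy'⟩ h
    have h0 := congr_fun h 0
    simp only [hφ, Pi.sub_apply, hy, hy', Pi.single_eq_same, zero_sub, neg_inj] at h0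
    subst h0
    have hyy : (y : Site d) = y' := sub_left_injective h
    subst hyy
    rfl
  have hpt : ∀ q : ℤ × {y : Site d // y 0 = 0},
      μ (openConn (Pi.single 0 q.1 : Site d) (q.2 : Site d)) = μ (openConn (0 : Site d) (φ q)) := by
    intro q
    have h := tau_eq_tau_zero_sub (d := d) p (Pi.single 0 q.1 : Site d) (q.2 : Site d)
    rw [tau_def, tau_def] at h
    exact (ENNReal.toReal_eq_toReal_iff' (measure_ne_top _ _) (measure_ne_top _ _)).1 h
  have hfin : ∑' t, μ (E t) ≠ ⊤ := by
    have h1 : ∀ t, μ (E t) ≤ ∑' y : {y : Site d // y 0 = 0}, μ (openConn (Pi.single 0 t : Site d) (y : Site d)) := by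
      intro t
      refine (measure_mono ?_).trans (measure_iUnion_le _)
      rintro ω ⟨-, y, hy, hω⟩
      exact Set.mem_iUnion.2 ⟨⟨y, hy⟩, hω⟩
    have h2 : ∑' t, μ (E t) ≤ ∑' z : Site d, μ (openConn (0 : Site d) z) := by
      calc ∑' t, μ (E t) ≤ ∑' t, ∑' y : {y : Site d // y 0 = 0}, μ (openConn (Pi.single 0 t : Site d) (y : Site d)) :=
            ENNReal.tsum_le_tsum h1
        _ = ∑' q : ℤ × {y : Site d // y 0 = 0}, μ (openConn (Pi.single 0 q.1 : Site d) (q.2 : Site d)) :=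
            (ENNReal.tsum_prod' (f := fun q : ℤ × {y : Site d // y 0 = 0} =>
              μ (openConn (Pi.single 0 q.1 : Site d) (q.2 : Site d)))).symm
        _ = ∑' q : ℤ × {y : Site d // y 0 = 0}, μ (openConn (0 : Site d) (φ q)) := by simp_rw [hpt]
        _ ≤ ∑' z : Site d, μ (openConn (0 : Site d) z) :=
            ENNReal.tsum_comp_le_tsum_of_injective hφinj fun z => μ (openConn (0 : Site d) z)
    have h3 : ∑' z : Site d, μ (openConn (0 : Site d) z) = ENNReal.ofReal (∑' z : Site d, μ.real (openConn (0 : Site d) z)) := by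
      rw [ENNReal.ofReal_tsum_of_nonneg (fun _ => measureReal_nonneg) hsum]
      exact tsum_congr fun z => (ofReal_measureReal (measure_ne_top _ _)).symm
    exact ne_top_of_le_ne_top (by rw [h3]; exact ENNReal.ofReal_ne_top) h2
  -- Borel–Cantelli
  filter_upwards [ae_finite_setOf_mem hfin] with ω hω
  simpa only [hE, Set.mem_setOf_eq] using hω

end PercCriticalCapsCapBelowCritical

end Summit.CriticalPhenomena.PercolationContinuityZ3.Theorems

end
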